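import Literature.Computability.AlgebraicComplexity.KIReductionCodes
import Literature.Computability.AlgebraicComplexity.ArithCircuitCodeBounds
import Literature.Computability.AlgebraicComplexity.CircuitConstantCount
import Literature.Computability.AlgebraicComplexity.ConstantFreeDegree
import Literature.Computability.Complexity.TM2PassThrough
import HarnessLib

/-!
# Circuits over `𝔽_p` as integer circuit codes of controlled length

Topic `Computability/AlgebraicComplexity`. Brick B6 of the route of record to BIJL18 Thm. 6
(Bläser–Ikenmeyer–Jindal–Lysikov 2018, proof of Thms. 5–6, ECCC TR18-064 pp. 18–19: "we switch to
`𝔽_p`", the guessed circuits for `per_k` over `𝔽_p` are STRINGS of polynomial length because their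
constants have `log p` bits). Two pieces of bookkeeping the tree lacked:

* §1 **an UPPER bound on the length of the tree's circuit codes** (`encodeArithCircuit`,
  `KIReduction.circuitWord`; the tree had only the lower bound
  `ArithCircuit.edgeSize_add_size_le_length_encode`): for an integer circuit over `m` variables
  whose constants and coefficients have absolute value `≤ A` (`ArithCircuit.ConstLe A`) and whose
  gate references point below `R` (`ArithCircuit.RefsLT R`, automatic for well-formed circuits),
  `|encodeArithCircuit m C| ≤ 24 · (edgeSize C + size C + 1) · (size A + size R + size m + 6)` and
  `|circuitWord m C| ≤ 26 · (edgeSize C + size C + 1) · (size A + size R + size m + 6)`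
  (`Nat.size x = ⌊log₂ x⌋ + 1` for `x ≥ 1`; `length_encodeArithCircuit_le`, `length_circuitWord_le`,
  well-formed forms `…_of_wellFormed`);
* §2–§3 **the integer lift of a circuit over `ZMod p`** (`ArithCircuit.liftZMod`: junk references
  trimmed by the tree's `trimJunk`, then every constant/coefficient replaced by its representative
  `ZMod.val ∈ [0, p)` via the tree's `mapConsts`): it reduces back to (the trimmed) `P` along
  `Int.castRingHom (ZMod p)` (`map_liftZMod`), so `map (ℤ → ZMod p) (liftZMod P).eval = P.eval`
  (`eval_liftZMod`); it is well formed and has the same size, fan-ins, edge size and formal degree;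
  its constants lie in `[0, p)`; and its code word has length
  `≤ 26 · (edgeSize P + size P + 1) · (size p + size (size P) + size m + 6)`
  (`length_circuitWord_liftZMod_le`), packaged as `exists_intCircuit_of_zmod` (memo shape).

Theorem-only apart from the definition `ArithCircuit.liftZMod`; no named facts. Honest framing:
string bookkeeping for the verifier of a 2018 conditional barrier theorem; nothing here bears on
`VP` versus `VNP`.

## References

* [BlaserIkenmeyerJindalLysikov2018] M. Bläser, C. Ikenmeyer, G. Jindal, V. Lysikov, *Generalized
  matrix completion and algebraic natural proofs*, STOC 2018 / ECCC TR18-064, §6 (proof of Thm. 5,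
  steps over `𝔽_p`, pp. 18–19).
* [KabanetsImpagliazzo2004] V. Kabanets, R. Impagliazzo, Comput. Complexity 13 (2004), §2 (circuits
  as strings; the tree's `arithCircuitEncoding`).
* [AroraBarak2009] S. Arora, B. Barak, *Computational Complexity*, CUP 2009, §0.1 (codes of pairs and
  lists: `|⟨x, y⟩| = 2|x| + 2 + |y|`).
* [Burgisser2000] P. Bürgisser, *Completeness and Reduction in Algebraic Complexity Theory*, 2000,
  Def. 2.1 and §4.1 (circuits, change of scalars).
-/

noncomputable section

open Computability
open Literature.Computability.Complexity

namespace Literature.Computability.AlgebraicComplexity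

universe u v w

/-! ## §1 Upper bounds on code lengths -/

namespace KIReduction

open ArithCircuit QuantumComplexity.BosonCodes

/-- `ones n` has length `n`. [folklore] -/
private theorem length_ones_eq (n : ℕ) : (ones n).length = n := List.length_replicate ..

/-- `|bin x| = size x ≤ size N` for `x ≤ N`. [folklore] -/
private theorem length_encodeNat_le_size {x N : ℕ} (h : x ≤ N) : (encodeNat x).length ≤ N.size := by
  rw [TM2Pass.length_encodeNat_eq_size]
  exact Nat.size_le_size h

/-- **Length of an operand code** over `m` variables: with constant `≤ A` in absolute value and gate
reference `< R`, `|opCode m u| ≤ size A + size R + size m + 6`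
(`00·bin k`, `01·⟨sign, bin |c|⟩`, `1·bin j`). [cite: KabanetsImpagliazzo2004, §2] -/
theorem length_opCode_le {m A R : ℕ} (u : Operand ℤ (Fin m)) (hc : u.ConstLe A)
    (hr : u.RefsBelow R) : (opCode m u).length ≤ A.size + R.size + m.size + 6 := by
  cases u with
  | var k =>
    rw [opCode_var, List.length_cons, List.length_cons]
    have := length_encodeNat_le_size k.is_lt.le
    omega
  | const c =>
    rw [opCode_const, List.length_cons, List.length_cons, length_intCode]
    have := length_encodeNat_le_size (show c.natAbs ≤ A from hc)
    omega
  | gate j =>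
    rw [opCode_gate, List.length_cons]
    have := length_encodeNat_le_size (show j < R from hr).le
    omega

/-- **Length of a gate code**: with coefficients/constants `≤ A`, references `< R`, over `m`
variables, `|gateCode m g| ≤ fanIn g · (6 (size A + size R + size m) + 36) + 3`
(`tag · ⟨1^{fan-in}, encList items⟩`, a sum item `⟨intCode c, opCode u⟩`, a product item
`opCode u`). [cite: KabanetsImpagliazzo2004, §2] [cite: AroraBarak2009, §0.1] -/
theorem length_gateCode_le {m A R : ℕ} (g : Gate ℤ (Fin m)) (hc : g.ConstLe A)
    (hr : ∀ u ∈ g.args, u.RefsBelow R) :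
    (gateCode m g).length ≤ g.fanIn * (6 * (A.size + R.size + m.size) + 36) + 3 := by
  set β := A.size + R.size + m.size with hβ
  cases g with
  | sum args =>
    rw [gateCode_sum, List.length_cons, length_boolPair, length_ones_eq, length_encList, List.map_map]
    have hf : (Gate.sum args).fanIn = args.length := by simp [Gate.fanIn, ArithCircuit.Gate.args]
    rw [hf]
    have hitem : ∀ x ∈ args.map ((fun a : List Bool => 2 * a.length + 2) ∘
        fun a : ℤ × Operand ℤ (Fin m) => boolPair (intCode a.1) (opCode m a.2)), x ≤ 6 * β + 34 := by
      intro x hx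
      obtain ⟨a, ha, rfl⟩ := List.mem_map.1 hx
      simp only [Function.comp_apply, length_boolPair, length_intCode]
      have h1 := length_encodeNat_le_size (hc a ha).1
      have h2 := length_opCode_le a.2 (hc a ha).2 (hr a.2 (by
        simp only [ArithCircuit.Gate.args, List.mem_map]; exact ⟨a, ha, rfl⟩))
      omega
    have hsum := List.sum_le_card_nsmul _ _ hitem
    rw [List.length_map, smul_eq_mul] at hsum
    nlinarith [hsum]
  | prod args =>
    rw [gateCode_prod, List.length_cons, length_boolPair, length_ones_eq, length_encList, List.map_map]
    have hf : (Gate.prod args).fanIn = args.length := by simp [Gate.fanIn, ArithCircuit.Gate.args]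
    rw [hf]
    have hitem : ∀ x ∈ args.map ((fun a : List Bool => 2 * a.length + 2) ∘ opCode m), x ≤ 6 * β + 34 := by
      intro x hx
      obtain ⟨u, hu, rfl⟩ := List.mem_map.1 hx
      simp only [Function.comp_apply]
      have h2 := length_opCode_le u (hc u hu) (hr u hu)
      omega
    have hsum := List.sum_le_card_nsmul _ _ hitem
    rw [List.length_map, smul_eq_mul] at hsum
    nlinarith [hsum]

/-- **Length of a circuit code** (`⟨⟨1^{#gates}, encList (gate codes)⟩, opCode output⟩`): with all
coefficients and constants of absolute value `≤ A` and all gate references `< R`,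
`|encodeArithCircuit m C| ≤ 24 · (edgeSize C + size C + 1) · (size A + size R + size m + 6)`.
[cite: KabanetsImpagliazzo2004, §2] [cite: AroraBarak2009, §0.1] -/
theorem length_encodeArithCircuit_le {m A R : ℕ} (C : ArithCircuit ℤ (Fin m)) (hc : C.ConstLe A)
    (hr : C.RefsLT R) :
    (encodeArithCircuit m C).length ≤ 24 * (C.edgeSize + C.size + 1) * (A.size + R.size + m.size + 6) := by
  set β := A.size + R.size + m.size with hβ
  rw [encodeArithCircuit_eq, length_boolPair, length_boolPair, length_ones_eq, length_encList, List.map_map]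
  have hgate : ∀ g ∈ C.gates, ((fun a : List Bool => 2 * a.length + 2) ∘ gateCode m) g ≤
      (fun g : Gate ℤ (Fin m) => g.fanIn * (12 * β + 72) + 8) g := by
    intro g hg
    simp only [Function.comp_apply]
    have := length_gateCode_le g (hc.1 g hg) (hr.1 g hg)
    nlinarith [this]
  have hsum : (C.gates.map ((fun a : List Bool => 2 * a.length + 2) ∘ gateCode m)).sum ≤
      (C.gates.map fun g : Gate ℤ (Fin m) => g.fanIn * (12 * β + 72) + 8).sum := List.sum_le_sum hgate
  have hsplit : (C.gates.map fun g : Gate ℤ (Fin m) => g.fanIn * (12 * β + 72) + 8).sum =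
      (C.gates.map Gate.fanIn).sum * (12 * β + 72) + 8 * C.gates.length := by
    rw [List.sum_map_add, List.sum_map_mul_right]
    simp [mul_comm]
  have hout := length_opCode_le C.output hc.2 hr.2
  have hE : C.edgeSize = (C.gates.map Gate.fanIn).sum := rfl
  have hS : C.size = C.gates.length := rfl
  rw [hE, hS]
  nlinarith [hsum, hsplit, hout, Nat.zero_le β, Nat.zero_le (C.gates.map Gate.fanIn).sum,
    Nat.zero_le C.gates.length]

/-- **Length of the word `⟨bin m, code C⟩`** submitted to `PITLanguage`:
`|circuitWord m C| ≤ 26 · (edgeSize C + size C + 1) · (size A + size R + size m + 6)`.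
[cite: KabanetsImpagliazzo2004, §2] -/
theorem length_circuitWord_le {m A R : ℕ} (C : ArithCircuit ℤ (Fin m)) (hc : C.ConstLe A)
    (hr : C.RefsLT R) :
    (circuitWord m C).length ≤ 26 * (C.edgeSize + C.size + 1) * (A.size + R.size + m.size + 6) := by
  rw [circuitWord, length_boolPair]
  have h1 := length_encodeArithCircuit_le C hc hr
  have h2 : (encodeNat m).length ≤ m.size := length_encodeNat_le_size le_rfl
  nlinarith [h1, h2, Nat.zero_le (C.edgeSize + C.size), Nat.zero_le (A.size + R.size)]

/-- Well-formed form: the references of a well-formed circuit point below its size, so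
`|circuitWord m C| ≤ 26 · (edgeSize C + size C + 1) · (size A + size (size C) + size m + 6)`.
[cite: KabanetsImpagliazzo2004, §2] -/
theorem length_circuitWord_le_of_wellFormed {m A : ℕ} (C : ArithCircuit ℤ (Fin m)) (hc : C.ConstLe A)
    (hwf : C.WellFormed) :
    (circuitWord m C).length ≤ 26 * (C.edgeSize + C.size + 1) * (A.size + C.size.size + m.size + 6) :=
  length_circuitWord_le C hc (refsLT_of_wellFormed hwf le_rfl)

/-- `size x ≤ ⌊log₂ x⌋ + 1` (for the `Nat.log 2` currency of the bounds). [folklore] -/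
private theorem size_le_log_succ (x : ℕ) : x.size ≤ Nat.log 2 x + 1 := by
  rw [← TM2Pass.length_encodeNat_eq_size]
  exact TM2Pass.length_encodeNat_le x

/-- The same bound in the `⌊log₂⌋` currency:
`|circuitWord m C| ≤ 26 · (edgeSize C + size C + 1) · (log₂ A + log₂ R + log₂ m + 9)`.
[cite: KabanetsImpagliazzo2004, §2] -/
theorem length_circuitWord_le_log {m A R : ℕ} (C : ArithCircuit ℤ (Fin m)) (hc : C.ConstLe A)
    (hr : C.RefsLT R) :
    (circuitWord m C).length ≤
      26 * (C.edgeSize + C.size + 1) * (Nat.log 2 A + Nat.log 2 R + Nat.log 2 m + 9) := by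
  refine (length_circuitWord_le C hc hr).trans (Nat.mul_le_mul_left _ ?_)
  have hA := size_le_log_succ A
  have hR := size_le_log_succ R
  have hm := size_le_log_succ m
  omega

end KIReduction

/-! ## §2 `trimJunk` and `mapConsts` keep fan-ins, edge size and formal degree -/

namespace ArithCircuit

variable {k : Type u} {k' : Type w} {σ : Type v}

/-- `trimJunk` keeps the list of fan-ins. [cite: Burgisser2000, Def. 2.1] -/
theorem map_fanIn_trimJunk [Zero k] (P : ArithCircuit k σ) :
    P.trimJunk.gates.map Gate.fanIn = P.gates.map Gate.fanIn := by
  simp only [trimJunk]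
  apply List.ext_getElem
  · simp
  · intro i h1 h2
    simp [List.getElem_mapIdx]

/-- `trimJunk` keeps the edge size. [cite: Burgisser2000, Def. 2.1] -/
@[simp] theorem edgeSize_trimJunk [Zero k] (P : ArithCircuit k σ) : P.trimJunk.edgeSize = P.edgeSize := by
  rw [edgeSize, edgeSize, map_fanIn_trimJunk]

/-- Truncating gate `i` at `i`, for every `i`, does not change the list of formal degrees (a junk
reference and the constant `0` both have formal degree `1`). [cite: Burgisser2006, §2.2] -/
theorem gateFormalDegrees_mapIdx_truncate [Zero k] (gs : List (Gate k σ)) :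
    gateFormalDegrees (gs.mapIdx fun i g => g.truncate i) = gateFormalDegrees gs := by
  induction gs using List.reverseRecOn with
  | nil => rfl
  | append_singleton gs g ih =>
    rw [List.mapIdx_concat, gateFormalDegrees_append_singleton, gateFormalDegrees_append_singleton, ih]
    congr 2
    have hlen : (gateFormalDegrees gs).length = gs.length := gateFormalDegrees_length gs
    cases g with
    | sum args =>
      simp only [Gate.truncate, Gate.formalDegree, List.map_map]
      congr 1
      refine List.map_congr_left fun a _ => ?_
      simp only [Function.comp_apply]
      have := Operand.formalDegree_truncate_append (k := k) (gateFormalDegrees gs) [] a.2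
      rwa [List.append_nil, hlen] at this
    | prod args =>
      simp only [Gate.truncate, Gate.formalDegree, List.map_map]
      congr 1
      refine List.map_congr_left fun u _ => ?_
      simp only [Function.comp_apply]
      have := Operand.formalDegree_truncate_append (k := k) (gateFormalDegrees gs) [] u
      rwa [List.append_nil, hlen] at this

/-- `trimJunk` keeps the formal degree. [cite: Burgisser2006, §2.2] -/
@[simp] theorem formalDegree_trimJunk [Zero k] (P : ArithCircuit k σ) :
    P.trimJunk.formalDegree = P.formalDegree := by
  have h := Operand.formalDegree_truncate_append (k := k) (gateFormalDegrees P.gates) [] P.output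
  rw [List.append_nil, gateFormalDegrees_length] at h
  change (P.output.truncate P.gates.length).formalDegree (gateFormalDegrees (P.gates.mapIdx fun i g => g.truncate i)) = _
  rw [gateFormalDegrees_mapIdx_truncate, h]
  rfl

/-- `Operand.map` keeps the formal degree. [cite: Burgisser2006, §2.2] -/
theorem Operand.formalDegree_map (φ : k → k') (degs : List ℕ) (u : Operand k σ) :
    (u.map φ).formalDegree degs = u.formalDegree degs := by
  cases u <;> rfl

/-- `Gate.map` keeps the formal degree. [cite: Burgisser2006, §2.2] -/
theorem Gate.formalDegree_map (φ : k → k') (degs : List ℕ) (g : Gate k σ) :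
    (g.map φ).formalDegree degs = g.formalDegree degs := by
  cases g with
  | sum args =>
    simp only [Gate.map, Gate.formalDegree, List.map_map]
    congr 1
    simp [Function.comp_def, Operand.formalDegree_map]
  | prod args =>
    simp only [Gate.map, Gate.formalDegree, List.map_map]
    congr 1
    simp [Function.comp_def, Operand.formalDegree_map]

/-- Mapping constants keeps the formal degrees of a gate list. [cite: Burgisser2006, §2.2] -/
theorem gateFormalDegrees_map_map (φ : k → k') (gs : List (Gate k σ)) :
    gateFormalDegrees (gs.map (Gate.map φ)) = gateFormalDegrees gs := by
  induction gs using List.reverseRecOn with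
  | nil => rfl
  | append_singleton gs g ih =>
    rw [List.map_append, List.map_singleton, gateFormalDegrees_append_singleton,
      gateFormalDegrees_append_singleton, ih, Gate.formalDegree_map]

/-- `mapConsts` keeps the formal degree. [cite: Burgisser2006, §2.2] -/
@[simp] theorem formalDegree_mapConsts (ρ : k → k') (P : ArithCircuit k σ) :
    (P.mapConsts ρ).formalDegree = P.formalDegree := by
  simp [formalDegree, mapConsts, gateFormalDegrees_map_map, Operand.formalDegree_map]

/-- `mapConsts` keeps the list of fan-ins. [cite: Burgisser2000, §4.1] -/
theorem map_fanIn_mapConsts (ρ : k → k') (P : ArithCircuit k σ) :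
    (P.mapConsts ρ).gates.map Gate.fanIn = P.gates.map Gate.fanIn := by
  simp [mapConsts, List.map_map, Function.comp_def, Gate.fanIn_map]

/-- `mapConsts` keeps the edge size. [cite: Burgisser2000, §4.1] -/
@[simp] theorem edgeSize_mapConsts (ρ : k → k') (P : ArithCircuit k σ) :
    (P.mapConsts ρ).edgeSize = P.edgeSize := by
  rw [edgeSize, edgeSize, map_fanIn_mapConsts]

/-- `Gate.map` acts on the operand list by `Operand.map`. [folklore] -/
private theorem Gate.args_map' (φ : k → k') (g : Gate k σ) :
    (g.map φ).args = g.args.map (Operand.map φ) := by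
  cases g <;> simp [Gate.map, Gate.args, List.map_map, Function.comp_def]

/-- `Operand.map` keeps the range of gate references. [folklore] -/
private theorem Operand.refsBelow_map' (φ : k → k') {n : ℕ} {u : Operand k σ} (h : u.RefsBelow n) :
    (u.map φ).RefsBelow n := by
  cases u with
  | var i => trivial
  | const c => trivial
  | gate j => exact h

/-- `mapConsts` keeps well-formedness. [cite: Burgisser2000, §4.1] -/
theorem WellFormed.mapConsts {P : ArithCircuit k σ} (h : P.WellFormed) (ρ : k → k') :
    (P.mapConsts ρ).WellFormed := by
  refine ⟨fun i g hg u hu => ?_, ?_⟩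
  · simp only [ArithCircuit.mapConsts, List.getElem?_map, Option.map_eq_some_iff] at hg
    obtain ⟨g₀, hg₀, rfl⟩ := hg
    rw [Gate.args_map', List.mem_map] at hu
    obtain ⟨u₀, hu₀, rfl⟩ := hu
    exact Operand.refsBelow_map' ρ (h.1 i g₀ hg₀ u₀ hu₀)
  · rw [size_mapConsts]
    exact Operand.refsBelow_map' ρ h.2

/-- The constants of `mapConsts ρ P` are the images of the constants of `P`. [cite: Burgisser2000, §4.1] -/
theorem consts_mapConsts (ρ : k → k') (P : ArithCircuit k σ) :
    (P.mapConsts ρ).consts = P.consts.map ρ := by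
  have hop : ∀ u : Operand k σ, (u.map ρ).consts = u.consts.map ρ := fun u => by
    cases u <;> rfl
  have hg : ∀ g : Gate k σ, (g.map ρ).consts = g.consts.map ρ := fun g => by
    cases g with
    | sum args =>
      simp [Gate.map, Gate.consts, List.map_map, hop, List.map_flatMap, List.flatMap_map]
    | prod args =>
      simp [Gate.map, Gate.consts, hop, List.map_flatMap, List.flatMap_map]
  simp [consts, mapConsts, List.map_flatMap, List.flatMap_map, hg, hop]

/-! ## §3 The integer lift of a circuit over `ZMod p` -/

section Lift

variable {p : ℕ}

/-- **The integer lift of a circuit over `ZMod p`**: trim the junk gate references (`trimJunk`, so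
that the result is well formed and its code is short), then replace every constant and sum
coefficient by its representative `ZMod.val ∈ [0, p)` (`mapConsts`). BIJL: "a circuit over `𝔽_p` …
encoded with constants of `log p` bits". [cite: BlaserIkenmeyerJindalLysikov2018, §6 (proof of Thm. 5 over `𝔽_p`)] -/
def liftZMod (P : ArithCircuit (ZMod p) σ) : ArithCircuit ℤ σ :=
  P.trimJunk.mapConsts fun c : ZMod p => (c.val : ℤ)

/-- Reducing the lift modulo `p` gives back the (junk-trimmed) circuit. [cite: Burgisser2000, §4.1] -/
theorem map_liftZMod [NeZero p] (P : ArithCircuit (ZMod p) σ) :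
    (liftZMod P).map (Int.castRingHom (ZMod p)) = P.trimJunk :=
  map_mapConsts_eq_self _ _ _ fun c _ => by simp

/-- **The lift computes `P.eval` modulo `p`.** [cite: BlaserIkenmeyerJindalLysikov2018, §6 (proof of Thm. 5 over `𝔽_p`)] -/
theorem eval_liftZMod [NeZero p] (P : ArithCircuit (ZMod p) σ) :
    MvPolynomial.map (Int.castRingHom (ZMod p)) (liftZMod P).eval = P.eval := by
  rw [← eval_map_apply, map_liftZMod, eval_trimJunk]

/-- Pointwise form: the value of the lift at an integer point reduces to the value of `P` at the
reduced point. [cite: BlaserIkenmeyerJindalLysikov2018, §6 (proof of Thm. 5 over `𝔽_p`)] -/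
theorem eval_eval_liftZMod [NeZero p] (P : ArithCircuit (ZMod p) σ) (x : σ → ℤ) :
    (Int.castRingHom (ZMod p)) (MvPolynomial.eval x (liftZMod P).eval) =
      MvPolynomial.eval (fun i => (x i : ZMod p)) P.eval := by
  change (Int.castRingHom (ZMod p)) (MvPolynomial.eval₂ (RingHom.id ℤ) x (liftZMod P).eval) = _
  rw [MvPolynomial.eval₂_comp_left, RingHom.comp_id, ← eval_liftZMod, MvPolynomial.eval_map]
  rfl

/-- The lift has the same size. [cite: Burgisser2000, §4.1] -/
@[simp] theorem size_liftZMod (P : ArithCircuit (ZMod p) σ) : (liftZMod P).size = P.size := by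
  rw [liftZMod, size_mapConsts, size_trimJunk]

/-- The lift has the same list of fan-ins (in particular fan-in exactly two is kept). [cite: Burgisser2000, §4.1] -/
theorem map_fanIn_liftZMod (P : ArithCircuit (ZMod p) σ) :
    (liftZMod P).gates.map Gate.fanIn = P.gates.map Gate.fanIn := by
  rw [liftZMod, map_fanIn_mapConsts, map_fanIn_trimJunk]

/-- The lift keeps "every gate has fan-in exactly two". [cite: Burgisser2000, §4.1] -/
theorem forall_fanIn_liftZMod {P : ArithCircuit (ZMod p) σ} {f : ℕ} (h : ∀ g ∈ P.gates, g.fanIn = f) :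
    ∀ g ∈ (liftZMod P).gates, g.fanIn = f := by
  intro g hg
  have hmem : g.fanIn ∈ (liftZMod P).gates.map Gate.fanIn := List.mem_map.2 ⟨g, hg, rfl⟩
  rw [map_fanIn_liftZMod, List.mem_map] at hmem
  obtain ⟨g', hg', he⟩ := hmem
  rw [← he, h g' hg']

/-- The lift keeps fan-in two. [cite: Burgisser2000, §4.1] -/
theorem IsFanInTwo.liftZMod {P : ArithCircuit (ZMod p) σ} (h : P.IsFanInTwo) : (liftZMod P).IsFanInTwo :=
  (h.trimJunk).mapConsts _

/-- The lift has the same edge size. [cite: Burgisser2000, §4.1] -/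
@[simp] theorem edgeSize_liftZMod (P : ArithCircuit (ZMod p) σ) : (liftZMod P).edgeSize = P.edgeSize := by
  rw [liftZMod, edgeSize_mapConsts, edgeSize_trimJunk]

/-- The lift has the same formal degree. [cite: Burgisser2006, §2.2] -/
@[simp] theorem formalDegree_liftZMod (P : ArithCircuit (ZMod p) σ) :
    (liftZMod P).formalDegree = P.formalDegree := by
  rw [liftZMod, formalDegree_mapConsts, formalDegree_trimJunk]

/-- The lift is well formed. [cite: Burgisser2000, Def. 2.1] -/
theorem wellFormed_liftZMod (P : ArithCircuit (ZMod p) σ) : (liftZMod P).WellFormed :=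
  (wellFormed_trimJunk P).mapConsts _

/-- The constants and coefficients of the lift lie in `[0, p)`. [cite: BlaserIkenmeyerJindalLysikov2018, §6 (proof of Thm. 5 over `𝔽_p`)] -/
theorem consts_liftZMod [NeZero p] (P : ArithCircuit (ZMod p) σ) :
    ∀ c ∈ (liftZMod P).consts, 0 ≤ c ∧ c < p := by
  intro c hc
  rw [liftZMod, consts_mapConsts, List.mem_map] at hc
  obtain ⟨a, -, rfl⟩ := hc
  exact ⟨by positivity, by exact_mod_cast a.val_lt⟩

/-- `Operand.map val` has constant `≤ p`. [folklore] -/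
private theorem Operand.constLe_map_val [NeZero p] (u : Operand (ZMod p) σ) :
    (u.map fun c : ZMod p => (c.val : ℤ)).ConstLe p := by
  cases u with
  | var i => trivial
  | gate j => trivial
  | const c =>
    change ((c.val : ℤ)).natAbs ≤ p
    rw [Int.natAbs_natCast]
    exact ZMod.val_le c

/-- The lift has constants and coefficients of absolute value `≤ p` (`ArithCircuit.ConstLe`). [cite: BlaserIkenmeyerJindalLysikov2018, §6 (proof of Thm. 5 over `𝔽_p`)] -/
theorem constLe_liftZMod [NeZero p] (P : ArithCircuit (ZMod p) σ) : (liftZMod P).ConstLe p := by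
  refine ⟨fun g hg => ?_, Operand.constLe_map_val _⟩
  simp only [liftZMod, ArithCircuit.mapConsts, List.mem_map] at hg
  obtain ⟨g₀, -, rfl⟩ := hg
  cases g₀ with
  | sum args =>
    simp only [Gate.map, Gate.ConstLe, List.mem_map]
    rintro _ ⟨a, -, rfl⟩
    refine ⟨?_, Operand.constLe_map_val a.2⟩
    rw [Int.natAbs_natCast]
    exact ZMod.val_le a.1
  | prod args =>
    simp only [Gate.map, Gate.ConstLe, List.mem_map]
    rintro _ ⟨u, -, rfl⟩
    exact Operand.constLe_map_val u

/-- **The code of the lift is short**: over `m` variables,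
`|circuitWord m (liftZMod P)| ≤ 26 · (edgeSize P + size P + 1) · (size p + size (size P) + size m + 6)`
— linear in the number of wires, logarithmic in `p`, the size and the number of variables.
[cite: BlaserIkenmeyerJindalLysikov2018, §6 (proof of Thm. 5 over `𝔽_p`)] [cite: KabanetsImpagliazzo2004, §2] -/
theorem length_circuitWord_liftZMod_le [NeZero p] {m : ℕ} (P : ArithCircuit (ZMod p) (Fin m)) :
    (KIReduction.circuitWord m (liftZMod P)).length ≤
      26 * (P.edgeSize + P.size + 1) * (p.size + P.size.size + m.size + 6) := by
  have h := KIReduction.length_circuitWord_le_of_wellFormed (liftZMod P) (constLe_liftZMod P)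
    (wellFormed_liftZMod P)
  rwa [edgeSize_liftZMod, size_liftZMod] at h

/-- The same bound in the `⌊log₂⌋` currency:
`|circuitWord m (liftZMod P)| ≤ 26 · (edgeSize P + size P + 1) · (log₂ p + log₂ (size P) + log₂ m + 9)`
("constants of `log p` bits"). [cite: BlaserIkenmeyerJindalLysikov2018, §6 (proof of Thm. 5 over `𝔽_p`)] -/
theorem length_circuitWord_liftZMod_le_log [NeZero p] {m : ℕ} (P : ArithCircuit (ZMod p) (Fin m)) :
    (KIReduction.circuitWord m (liftZMod P)).length ≤
      26 * (P.edgeSize + P.size + 1) * (Nat.log 2 p + Nat.log 2 P.size + Nat.log 2 m + 9) := by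
  have h := KIReduction.length_circuitWord_le_log (liftZMod P) (constLe_liftZMod P)
    (refsLT_of_wellFormed (wellFormed_liftZMod P) le_rfl)
  rwa [edgeSize_liftZMod, size_liftZMod] at h

/-- **Brick B6 of the BIJL18 Thm. 6 route, packaged** (shape of the route memo): every circuit over
`ZMod p` in `m` variables is, modulo `p`, an INTEGER circuit with the same size, fan-ins and formal
degree, well formed, with constants in `[0, p)`, whose code word has length
`≤ 26 · (edgeSize + size + 1) · (size p + size size + size m + 6)`.
[cite: BlaserIkenmeyerJindalLysikov2018, §6 (proof of Thm. 5 over `𝔽_p`)] -/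
theorem exists_intCircuit_of_zmod [NeZero p] {m : ℕ} (P : ArithCircuit (ZMod p) (Fin m)) :
    ∃ C : ArithCircuit ℤ (Fin m),
      C.WellFormed ∧ C.size = P.size ∧ C.gates.map Gate.fanIn = P.gates.map Gate.fanIn ∧
      C.edgeSize = P.edgeSize ∧ C.formalDegree = P.formalDegree ∧
      (∀ c ∈ C.consts, 0 ≤ c ∧ c < p) ∧
      MvPolynomial.map (Int.castRingHom (ZMod p)) C.eval = P.eval ∧
      (KIReduction.circuitWord m C).length ≤
        26 * (P.edgeSize + P.size + 1) * (p.size + P.size.size + m.size + 6) :=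
  ⟨liftZMod P, wellFormed_liftZMod P, size_liftZMod P, map_fanIn_liftZMod P, edgeSize_liftZMod P,
    formalDegree_liftZMod P, consts_liftZMod P, eval_liftZMod P, length_circuitWord_liftZMod_le P⟩

end Lift

end ArithCircuit

end Literature.Computability.AlgebraicComplexity
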